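import Summits.Schanuel.Schanuel.Theorems.RootDecomp1BFinitePinningFloor07

/-!
# `RootDecomp1BFinitePinningFloor` — part 08 of 08 (`RootDecomp1BFinitePinningFloor08`): §11 THE FINITE PINNING FLOOR AT LENGTH ONE, the floor — `linearIndependent_tG_int / _rat` (the unit circle has infinite algebraic rank), `linearIndependent_tG_A` (Baker), `exists_unimodular_algebraic_independent_args`, `exists_tG_not_mem`, `exists_pow_not_mem` (powers of a transcendental real escape every finite-dimensional `A`-subspace), `exp_tG_transcendental` (Gelfond–Schneider), `exists_fixedPoint_shear (F)`, `hyperplanePinningFloorOne (F)`, `finitePinningFloorOne (F)`, `finitePinningFloorOne_periodPackage (hN) (F)`, `finiteTablePinningFloorOne (hN) (T)`, `kleinPolarCellOne_/localSurplusBudget_/tameDefectZeroStep_false_without_channel_beyond_finite_pinning (hN) (F)` (+ hypothesis-free primed forms), `finitePinningFloorOne_exp_dictionary`: for EVERY finite table of values of `exp` a period-package model agreeing with it fails `X(1)` (at a transcendental fixed point), `X`, `LSB(1)`, `T0(0)`, `S(2)`, `S`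

Part 8 of the port of the lens-4 gen-23 kernel `FinitePinningFloor.lean`. Parts 07–08 (§11, appended 2026-08-30 to the six-part port 01–06; ≤ 400 lines each, shared namespace `Summit.Schanuel.Schanuel.Theorems.RootDecomp1BFinitePinningFloor`, each part importing the previous; `--supports stmt-Schanuel-24622`) of the decomp-schanuel lens-4 kernel file `HOME/decomp-schanuel-lens-4/g23/FinitePinningFloor.lean` (gen 23, §1–§11, sha256 92a2b0f8f9b538e5…; `lean check` rc 0 · 0 sorry · standard axioms; see part 01 for the overview of §1–§10, the construction of pinned shears and the reading for the crux). 
-/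

noncomputable section

open Complex


namespace Summit.Schanuel.Schanuel.Theorems.RootDecomp1BFinitePinningFloor

open Summit.Schanuel.Schanuel.Theorems.RootDecomp1BTranscendencePackageFloor
open Summit.Schanuel.Schanuel.Theorems.RootDecomp1BPeriodKernelFloor
open Literature.NumberTheory.Transcendental (nesterenko baker_holds SchanuelRank transcendental_pi_holds)

/-! ## §1 Helpers (part-local copies of the private helpers of the kernel file) -/

/-- `i` is algebraic. [folklore] -/
private theorem alg_I : IsAlgebraic ℚ I := mem_Qb_iff.mp I_mem_Qb

/-! ## §11 (continued) THE FINITE PINNING FLOOR AT LENGTH ONE — independence of the arguments, Baker, Gelfond–Schneider, the floor -/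

/-- **THE ARGUMENTS `t_j` ARE `ℤ`-FREE** (unique factorisation in `ℤ[i]`, §11 elementary form).
[folklore] -/
theorem linearIndependent_tG_int' {N : ℕ} (e : Fin N → ℕ) (he : Function.Injective e) :
    LinearIndependent ℤ fun j : Fin N => tG (e j) :=
  gaussian_linearIndependent_int_arg (q := fun j : Fin N => qG (e j)) (w := fun j : Fin N => wG (e j))
    (fun j => qG_prime _) (fun i j hij => he (qG_injective hij)) (fun j => qG_ne_two _)
    (fun j => wG_norm _)
    (fun j => by simpa [wG] using aG_zmod_ne_zero (e j)) (fun j => by simpa [wG] using bG_zmod_ne_zero (e j))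
    (fun j => norm_βG _)

/-- `t_0, …, t_{N-1}` are `ℤ`-free. [folklore] -/
theorem linearIndependent_tG_int (N : ℕ) : LinearIndependent ℤ fun j : Fin N => tG j :=
  linearIndependent_tG_int' (fun j : Fin N => (j : ℕ)) Fin.val_injective

/-- … hence `ℚ`-free. [folklore] -/
theorem linearIndependent_tG_rat (N : ℕ) : LinearIndependent ℚ fun j : Fin N => tG j :=
  (LinearIndependent.iff_fractionRing ℤ ℚ).mp (linearIndependent_tG_int N)

/-- `t_j ≠ 0` (`β_j` is not `1`; indeed not a root of unity). [folklore] -/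
theorem tG_ne_zero (j : ℕ) : tG j ≠ 0 :=
  (linearIndependent_tG_int' (fun _ : Fin 1 => j) fun a b _ => Subsingleton.elim a b).ne_zero 0

/-- The logarithms `i t_j = log β_j` are `ℚ`-free in `ℂ`. [folklore] -/
theorem linearIndependent_tGI_complex (N : ℕ) :
    LinearIndependent ℚ fun j : Fin N => ((tG j : ℝ) : ℂ) * I := by
  rw [Fintype.linearIndependent_iff]
  intro g hg
  have him := congrArg Complex.im hg
  rw [Complex.im_sum, Complex.zero_im] at him
  simp only [Rat.smul_def, Complex.mul_im, Complex.ratCast_re, Complex.ratCast_im,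
    Complex.ofReal_re, Complex.ofReal_im, Complex.I_re, Complex.I_im, Complex.mul_re, mul_zero, mul_one,
    sub_zero, add_zero] at him
  refine Fintype.linearIndependent_iff.mp (linearIndependent_tG_rat N) g ?_
  rw [← him]
  refine Finset.sum_congr rfl fun j _ => ?_
  rw [Rat.smul_def]

/-- **BAKER: the arguments `t_j` are linearly independent over `A = ℚ̄ ∩ ℝ`** (Baker's theorem at the
`ℚ`-free logarithms `i t_j` of the algebraic numbers `β_j`). [cite: Baker1966, 68] -/
theorem linearIndependent_tG_A (N : ℕ) : LinearIndependent A fun j : Fin N => tG j := by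
  classical
  let l : Fin N → ℂ := fun j => ((tG j : ℝ) : ℂ) * I
  have halg : ∀ j, IsAlgebraic ℚ (cexp (l j)) := fun j => by
    show IsAlgebraic ℚ (cexp (((tG j : ℝ) : ℂ) * I))
    rw [exp_tG_mul_I]
    exact βG_isAlgebraic j
  have hB := baker_holds l halg (linearIndependent_tGI_complex N)
  have hBl : LinearIndependent Qb l := hB.comp some (Option.some_injective _)
  rw [Fintype.linearIndependent_iff]
  intro c hc
  let g : Fin N → Qb := fun j => ⟨((c j : ℝ) : ℂ), mem_A_iff_coe_mem_Qb.mp (c j).2⟩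
  have hsum : ∑ j, g j • l j = 0 := by
    have h := congrArg (fun x : ℝ => (x : ℂ) * I) hc
    simp only [Complex.ofReal_zero, zero_mul] at h
    rw [← h, Complex.ofReal_sum, Finset.sum_mul]
    refine Finset.sum_congr rfl fun j _ => ?_
    rw [IntermediateField.smul_def, IntermediateField.smul_def, smul_eq_mul, smul_eq_mul,
      Complex.ofReal_mul, mul_assoc]
  have key := Fintype.linearIndependent_iff.mp hBl g hsum
  intro j
  have hj : ((c j : ℝ) : ℂ) = 0 := by
    have h := congrArg Subtype.val (key j)
    exact h
  have hj' : (c j : ℝ) = 0 := by exact_mod_cast hj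
  exact_mod_cast hj'

/-- **THE UNIT CIRCLE HAS INFINITE ALGEBRAIC RANK, `A`-free form**: for every `N`, `N` algebraic
numbers of modulus one whose arguments are linearly independent over `A = ℚ̄ ∩ ℝ` (and over `ℚ`).
[cite: Baker1966, 68] -/
theorem exists_unimodular_algebraic_independent_args (N : ℕ) :
    ∃ β : Fin N → ℂ, (∀ j, ‖β j‖ = 1 ∧ IsAlgebraic ℚ (β j)) ∧
      LinearIndependent ℚ (fun j => (β j).arg) ∧ LinearIndependent A (fun j => (β j).arg) :=
  ⟨fun j => βG j, fun j => ⟨norm_βG j, βG_isAlgebraic j⟩, linearIndependent_tG_rat N,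
    linearIndependent_tG_A N⟩

/-- Some argument `t_j` lies outside any finite-dimensional `A`-subspace `G` of `ℝ`. [cite: Baker1966, 68] -/
theorem exists_tG_not_mem (G : Submodule A ℝ) [Module.Finite A G] : ∃ j : ℕ, tG j ∉ G := by
  by_contra! hall
  let v : Fin (Module.finrank A G + 1) → G := fun j => ⟨tG j, hall j⟩
  have hv : LinearIndependent A v := by
    refine LinearIndependent.of_comp G.subtype ?_
    exact linearIndependent_tG_A _
  have h := hv.fintype_card_le_finrank
  rw [Fintype.card_fin] at h
  omega

/-! ### Powers of a transcendental real escape every finite-dimensional `A`-subspace -/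

/-- A real which is transcendental as a complex number is transcendental over `A`. [folklore] -/
theorem transcendental_A_of_coe {x : ℝ} (hx : Transcendental ℚ (x : ℂ)) : Transcendental A x := by
  haveI : Algebra.IsAlgebraic ℚ A := algebraicClosure.isAlgebraic ℚ ℝ
  intro h
  have h1 : IsAlgebraic ℚ x := h.restrictScalars ℚ
  exact hx (by simpa using h1.algebraMap (A := ℂ))

/-- Distinct powers of a real transcendental over `A` are `A`-free. [folklore] -/
theorem linearIndependent_pow_A {x : ℝ} (hx : Transcendental A x) {ι : Type*} [Fintype ι] (e : ι → ℕ)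
    (he : Function.Injective e) : LinearIndependent A fun i => x ^ e i := by
  rw [Fintype.linearIndependent_iff]
  intro c hc
  refine pow_relation_trivial_of_transcendental hx e he c ?_
  rw [← hc]
  refine Finset.sum_congr rfl fun i _ => ?_
  rw [Algebra.smul_def]

/-- Some power `x^k`, `k ≥ 1`, of a transcendental real lies outside any finite-dimensional
`A`-subspace. [folklore] -/
theorem exists_pow_not_mem {x : ℝ} (hx : Transcendental A x) (F : Submodule A ℝ) [Module.Finite A F] :
    ∃ k : ℕ, 0 < k ∧ x ^ k ∉ F := by
  by_contra! hall
  let v : Fin (Module.finrank A F + 1) → F := fun k => ⟨x ^ ((k : ℕ) + 1), hall _ (Nat.succ_pos _)⟩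
  have hv : LinearIndependent A v := by
    refine LinearIndependent.of_comp F.subtype ?_
    exact linearIndependent_pow_A hx (fun k : Fin (Module.finrank A F + 1) => (k : ℕ) + 1)
      (fun i j hij => Fin.ext (by simpa using hij))
  have h := hv.fintype_card_le_finrank
  rw [Fintype.card_fin] at h
  omega

/-! ### The model at level `F` and the floor -/

/-- **GELFOND–SCHNEIDER: `γ_j = e^{t_j} = β_j^{-i}` is transcendental.** [cite: Gelfond1934] -/
theorem exp_tG_transcendental (j : ℕ) : Transcendental ℚ ((Real.exp (tG j) : ℝ) : ℂ) := by
  have hl : (tG j : ℂ) * I ≠ 0 := mul_ne_zero (by exact_mod_cast tG_ne_zero j) I_ne_zero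
  have hb : (-I) ∉ Set.range ((↑) : ℚ → ℂ) := by
    rintro ⟨q, hq⟩
    have him := congrArg Complex.im hq
    simp at him
  have h := Literature.NumberTheory.Transcendental.gelfond_schneider_holds (βG_isAlgebraic j) alg_I.neg
    hb (exp_tG_mul_I j) hl
  have e : cexp (-I * ((tG j : ℂ) * I)) = ((Real.exp (tG j) : ℝ) : ℂ) := by
    rw [Complex.ofReal_exp]
    congr 1
    linear_combination (-(tG j : ℂ)) * I_sq
  rwa [e] at h

/-- **THE PINNED FIXED-POINT SHEAR AT LEVEL `F`.** For every finite-dimensional `A`-subspace `F` of `ℝ`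
there are a shear `S` whose functional kills `F`, `1` and `π`, a natural `k ≥ 1` and an index `j` with
`S.u = γ_j^k = e^{k t_j} ∉ F`, `S.ℓ = k t_j`: so `E_S(u) = u` is a TRANSCENDENTAL FIXED POINT and
`E_S(iu) = β_j^k` is ALGEBRAIC. [cite: Baker1966, 68] -/
theorem exists_fixedPoint_shear (F : Submodule A ℝ) [Module.Finite A F] :
    ∃ (S : Shear) (j k : ℕ), (∀ x ∈ F, S.φ x = 0) ∧ S.φ Real.pi = 0 ∧ 0 < k ∧
      S.u = Real.exp (tG j) ^ k ∧ S.ℓ = k * tG j ∧ S.u ∉ spanOnePi ∧ S.d ≠ 0 ∧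
      S.E (S.u : ℂ) = S.u ∧ S.E ((S.u : ℂ) * I) = βG j ^ k := by
  haveI := finite_spanOnePi
  let F₁ : Submodule A ℝ := F ⊔ spanOnePi
  obtain ⟨j, hj⟩ := exists_tG_not_mem F₁
  obtain ⟨k, hk, hγk⟩ :=
    exists_pow_not_mem (transcendental_A_of_coe (exp_tG_transcendental j)) F₁
  have hs : (k : ℝ) * tG j ∉ F₁ := by
    intro h
    apply hj
    have hk0 : (k : ℝ) ≠ 0 := by exact_mod_cast hk.ne'
    have e : tG j = ((k : A)⁻¹ : A) • ((k : ℝ) * tG j) := by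
      rw [Algebra.smul_def, map_inv₀, map_natCast, ← mul_assoc, inv_mul_cancel₀ hk0, one_mul]
    rw [e]
    exact Submodule.smul_mem _ _ h
  obtain ⟨φ, hF, hφu, hφℓ⟩ := exists_phi_of_not_mem' F₁ hγk hs
  have h1 : (1 : ℝ) ∈ F₁ := Submodule.mem_sup_right one_mem_spanOnePi
  have hπ : Real.pi ∈ F₁ := Submodule.mem_sup_right pi_mem_spanOnePi
  let S : Shear := ⟨φ, Real.exp (tG j) ^ k, k * tG j, hF 1 h1, hφu, hφℓ⟩
  have hexp : Real.exp (tG j) ^ k = Real.exp (k * tG j) := by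
    rw [← Real.exp_nat_mul]
  refine ⟨S, j, k, fun x hx => hF x (Submodule.mem_sup_left hx), hF _ hπ, hk, rfl, rfl,
    fun h => hγk (Submodule.mem_sup_right h), ?_, ?_, ?_⟩
  · show (k : ℝ) * tG j - Real.exp (tG j) ^ k ≠ 0
    rw [hexp]
    have h := Real.add_one_le_exp ((k : ℝ) * tG j)
    intro h0
    linarith [sub_eq_zero.mp h0]
  · rw [E_u]
    show cexp (((k * tG j : ℝ)) : ℂ) = ((Real.exp (tG j) ^ k : ℝ) : ℂ)
    rw [hexp, Complex.ofReal_exp]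
  · rw [E_u_mul_I]
    show cexp (((k * tG j : ℝ) : ℂ) * I) = βG j ^ k
    push_cast
    rw [mul_assoc, Complex.exp_nat_mul, exp_tG_mul_I]

/-- **FINITE PINNING FLOOR AT LENGTH ONE (hyperplane form).** For EVERY finite-dimensional
`A`-subspace `F ⊂ ℝ` there are an `A`-hyperplane `H ⊇ F` (`ℝ = H ⊕ A·u`) and an exponential `E`
AGREEING WITH `exp` ON `H ⊕ iH`, with (E1)–(E4), the TRUE kernel, the period plane, Nesterenko
verbatim (granted `nesterenko`), discontinuous and non-measurable, with a TRANSCENDENTAL FIXED POINT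
`E u = u` at which `E(iu)` is algebraic — which FAILS the length-one cell at `u`, Klein-polar Schanuel,
the Local Surplus Budget (at length one), the Tame Defect-Zero Step (at storey zero), Schanuel in rank
two (at `(u, iu)`) and the summit text. [cite: Baker1966, 68] -/
theorem hyperplanePinningFloorOne (F : Submodule A ℝ) [Module.Finite A F] :
    ∃ (E : ℂ → ℂ) (H : Submodule A ℝ) (u : ℝ), F ≤ H ∧ H ≠ ⊤ ∧ H ⊔ Submodule.span A {u} = ⊤ ∧
      H ⊓ Submodule.span A {u} = ⊥ ∧ AgreesOn E H ∧
      TranscendencePackage E ∧ TrueKernel E ∧ AgreesOnPeriodPlane E ∧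
      (nesterenko → NesterenkoE E) ∧ ¬ Continuous E ∧ ¬ Measurable (fun x : ℝ => E x) ∧
      u ≠ 0 ∧ Transcendental ℚ (u : ℂ) ∧ E u = u ∧ IsAlgebraic ℚ (E (u * I)) ∧
      ¬ KleinPolarCellOne E u ∧ ¬ KleinPolarE E ∧ ¬ LocalSurplusBudgetE E ∧
      ¬ TameDefectZeroStepE E ∧ ¬ SchanuelRankE E 2 ∧ ¬ SchanuelE E := by
  obtain ⟨S, j, k, hF, hφπ, hk, hu, hℓ, hus, hd, hfix, halg⟩ := exists_fixedPoint_shear F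
  have hu0 : S.u ≠ 0 := ne_zero_of_not_mem_spanOnePi hus
  have hut : Transcendental ℚ ((S.u : ℝ) : ℂ) := transcendental_of_not_mem_spanOnePi hus
  have hb : IsAlgebraic ℚ (βG j ^ k) := (βG_isAlgebraic j).pow k
  let K : IntermediateField ℚ ℂ := IntermediateField.adjoin ℚ ({((S.u : ℝ) : ℂ), βG j ^ k} : Set ℂ)
  have hK : Algebra.trdeg ℚ K ≤ 1 := trdeg_adjoin_pair_le_one _ hb
  have hrK : ((S.u : ℝ) : ℂ) ∈ K := IntermediateField.subset_adjoin ℚ _ (Set.mem_insert _ _)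
  have hsK : cexp (S.ℓ : ℂ) ∈ K := by
    rw [← E_u, hfix]
    exact hrK
  have hisK : cexp ((S.ℓ : ℂ) * I) ∈ K := by
    rw [← E_u_mul_I, halg]
    exact IntermediateField.subset_adjoin ℚ _ (Set.mem_insert_of_mem _ rfl)
  have hcell := not_kleinPolarCellOne_shear S K hK hrK hsK hisK
  refine ⟨S.E, fixedSpace S, S.u, fun x hx => mem_fixedSpace.mpr (hF x hx), fixedSpace_ne_top S,
    fixedSpace_sup_span_u S, fixedSpace_inf_span_u S, agreesOn_fixedSpace S,
    transcendencePackage_shear S, trueKernel_of S hφπ, agreesOnPeriodPlane_of S hφπ,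
    fun hN => nesterenkoE_of S hN hφπ, S.not_continuous_E hd, not_measurable_E_ofReal S hd, hu0, hut,
    hfix, by rw [halg]; exact hb, hcell, fun hX => hcell (kleinPolarCellOne_of_kleinPolarE hX hu0),
    not_localSurplusBudgetE_shear S K hK hrK hsK hisK hut,
    not_tameDefectZeroStepE_shear S K hK hrK hsK hisK hut,
    not_schanuelRankE_two_shear S K hK hrK hsK hisK hu0, not_schanuelE_shear S K hK hrK hsK hisK hu0⟩

/-- **FINITE PINNING FLOOR AT LENGTH ONE.** For EVERY finite-dimensional `A`-subspace `F ⊂ ℝ`: an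
exponential with (E1)–(E4), (P1), (P2) ((P3) granted `nesterenko`), `E = exp` on `F ⊕ iF`, and a
real `u ≠ 0` with `E u = u` transcendental, `E(iu)` algebraic, failing `X(1)` at `u`, `X`, `LSB`,
`T0`, `S(2)`, `S`. [cite: Baker1966, 68] -/
theorem finitePinningFloorOne (F : Submodule A ℝ) [Module.Finite A F] :
    ∃ (E : ℂ → ℂ) (u : ℝ), TranscendencePackage E ∧ TrueKernel E ∧ AgreesOnPeriodPlane E ∧
      AgreesOn E F ∧ (nesterenko → NesterenkoE E) ∧ ¬ Continuous E ∧
      ¬ Measurable (fun x : ℝ => E x) ∧ u ≠ 0 ∧ Transcendental ℚ (u : ℂ) ∧ E u = u ∧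
      IsAlgebraic ℚ (E (u * I)) ∧ ¬ KleinPolarCellOne E u ∧ ¬ KleinPolarE E ∧
      ¬ LocalSurplusBudgetE E ∧ ¬ TameDefectZeroStepE E ∧ ¬ SchanuelRankE E 2 ∧ ¬ SchanuelE E := by
  obtain ⟨E, H, u, hFH, _, _, _, hA, h₁, h₂, h₃, h₄⟩ := hyperplanePinningFloorOne F
  exact ⟨E, u, h₁, h₂, h₃, hA.mono hFH, h₄⟩

/-- … with the PERIOD PACKAGE spelled out (granted Nesterenko). [cite: Nesterenko1996SbMath, Theorem 1 and its corollaries] -/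
theorem finitePinningFloorOne_periodPackage (hN : nesterenko) (F : Submodule A ℝ) [Module.Finite A F] :
    ∃ (E : ℂ → ℂ) (u : ℝ), PeriodPackage E ∧ AgreesOn E F ∧ u ≠ 0 ∧ E u = u ∧
      ¬ KleinPolarCellOne E u ∧ ¬ KleinPolarE E ∧ ¬ LocalSurplusBudgetE E ∧ ¬ TameDefectZeroStepE E ∧
      ¬ SchanuelRankE E 2 ∧ ¬ SchanuelE E := by
  obtain ⟨E, u, hT, hK, hP, hA, hNE, -, -, hu0, -, hfix, -, hrest⟩ := finitePinningFloorOne F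
  exact ⟨E, u, ⟨hT, hK, hP, hNE hN⟩, hA, hu0, hfix, hrest⟩

/-- **NO FINITE TABLE OF VALUES OF `exp` DECIDES EVEN THE FIRST POLAR CELL**: for every FINITE set
`T ⊂ ℂ` there is an exponential `E` with the period package (granted `nesterenko`) and `E = exp` ON `T`
(indeed on the `A`-span of `re T ∪ im T`, plus `i` times it) failing `X(1)` (at a transcendental
fixed point), `X`, `LSB`, `T0`, `S(2)`, `S`. [cite: Nesterenko1996SbMath, Theorem 1 and its corollaries] -/
theorem finiteTablePinningFloorOne (hN : nesterenko) {T : Set ℂ} (hT : T.Finite) :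
    ∃ (E : ℂ → ℂ) (u : ℝ), PeriodPackage E ∧ (∀ z ∈ T, E z = cexp z) ∧ u ≠ 0 ∧ E u = u ∧
      ¬ KleinPolarCellOne E u ∧ ¬ KleinPolarE E ∧ ¬ LocalSurplusBudgetE E ∧ ¬ TameDefectZeroStepE E ∧
      ¬ SchanuelRankE E 2 ∧ ¬ SchanuelE E := by
  let T' : Set ℝ := Complex.re '' T ∪ Complex.im '' T
  have hT' : T'.Finite := (hT.image _).union (hT.image _)
  haveI : Module.Finite A (Submodule.span A T') := Module.Finite.span_of_finite A hT'
  obtain ⟨E, u, hP, hA, hrest⟩ := finitePinningFloorOne_periodPackage hN (Submodule.span A T')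
  refine ⟨E, u, hP, fun z hz => hA z ?_ ?_, hrest⟩
  · exact Submodule.subset_span (Or.inl ⟨z, hz, rfl⟩)
  · exact Submodule.subset_span (Or.inr ⟨z, hz, rfl⟩)

/-- **`KleinPolarSchanuel` AT LENGTH ONE IS FALSE WITHOUT A CHANNEL BEYOND FINITE PINNING**: for
every finite-dimensional `F`, `¬ ∀ E, PeriodPackage E → AgreesOn E F → ∀ r ≠ 0, X_E(1) at r`.
[cite: Nesterenko1996SbMath, Theorem 1 and its corollaries] -/
theorem kleinPolarCellOne_false_without_channel_beyond_finite_pinning (hN : nesterenko)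
    (F : Submodule A ℝ) [Module.Finite A F] :
    ¬ ∀ E : ℂ → ℂ, PeriodPackage E → AgreesOn E F → ∀ r : ℝ, r ≠ 0 → KleinPolarCellOne E r := by
  intro h
  obtain ⟨E, u, hP, hA, hu0, -, hcell, -⟩ := finitePinningFloorOne_periodPackage hN F
  exact hcell (h E hP hA u hu0)

/-- **`LocalSurplusBudget` IS FALSE WITHOUT A CHANNEL BEYOND FINITE PINNING** (crux stmt-Schanuel-27214).
[cite: Nesterenko1996SbMath, Theorem 1 and its corollaries] -/
theorem localSurplusBudget_false_without_channel_beyond_finite_pinning (hN : nesterenko)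
    (F : Submodule A ℝ) [Module.Finite A F] :
    ¬ ∀ E : ℂ → ℂ, PeriodPackage E → AgreesOn E F → LocalSurplusBudgetE E := by
  intro h
  obtain ⟨E, u, hP, hA, -, -, -, -, hL, -⟩ := finitePinningFloorOne_periodPackage hN F
  exact hL (h E hP hA)

/-- **`TameDefectZeroStep` IS FALSE WITHOUT A CHANNEL BEYOND FINITE PINNING** (crux stmt-Schanuel-32407).
[cite: Nesterenko1996SbMath, Theorem 1 and its corollaries] -/
theorem tameDefectZeroStep_false_without_channel_beyond_finite_pinning (hN : nesterenko)
    (F : Submodule A ℝ) [Module.Finite A F] :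
    ¬ ∀ E : ℂ → ℂ, PeriodPackage E → AgreesOn E F → TameDefectZeroStepE E := by
  intro h
  obtain ⟨E, u, hP, hA, -, -, -, -, -, hT0, -⟩ := finitePinningFloorOne_periodPackage hN F
  exact hT0 (h E hP hA)

/-- HYPOTHESIS-FREE FORM (length-one cell): `¬ ∀ E, (E1)–(E4) → (P1) → (P2) → E|_{F⊕iF} = exp →
∀ r ≠ 0, X_E(1) at r`. [cite: Baker1966, 68] -/
theorem kleinPolarCellOne_false_without_channel_beyond_finite_pinning' (F : Submodule A ℝ)
    [Module.Finite A F] :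
    ¬ ∀ E : ℂ → ℂ, TranscendencePackage E → TrueKernel E → AgreesOnPeriodPlane E → AgreesOn E F →
      ∀ r : ℝ, r ≠ 0 → KleinPolarCellOne E r := by
  intro h
  obtain ⟨E, u, hT, hK, hP, hA, -, -, -, hu0, -, -, -, hcell, -⟩ := finitePinningFloorOne F
  exact hcell (h E hT hK hP hA u hu0)

/-- HYPOTHESIS-FREE FORM (`LSB`). [cite: Baker1966, 68] -/
theorem localSurplusBudget_false_without_channel_beyond_finite_pinning' (F : Submodule A ℝ)
    [Module.Finite A F] :
    ¬ ∀ E : ℂ → ℂ, TranscendencePackage E → TrueKernel E → AgreesOnPeriodPlane E → AgreesOn E F →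
      LocalSurplusBudgetE E := by
  intro h
  obtain ⟨E, u, hT, hK, hP, hA, -, -, -, -, -, -, -, -, -, hL, -⟩ := finitePinningFloorOne F
  exact hL (h E hT hK hP hA)

/-- HYPOTHESIS-FREE FORM (`T0`). [cite: Baker1966, 68] -/
theorem tameDefectZeroStep_false_without_channel_beyond_finite_pinning' (F : Submodule A ℝ)
    [Module.Finite A F] :
    ¬ ∀ E : ℂ → ℂ, TranscendencePackage E → TrueKernel E → AgreesOnPeriodPlane E → AgreesOn E F →
      TameDefectZeroStepE E := by
  intro h
  obtain ⟨E, u, hT, hK, hP, hA, -, -, -, -, -, -, -, -, -, -, hT0, -⟩ := finitePinningFloorOne F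
  exact hT0 (h E hT hK hP hA)

/-- DICTIONARY at level `F`: `exp` has the period package (granted `nesterenko`) and agrees with itself
on `F ⊕ iF`; its instances of the statements are the route items / the tree's `SchanuelRank 2` / the
summit, and its length-one cells follow from the crux (`kleinPolarCellOne_of_kleinPolarE`).
[cite: Nesterenko1996SbMath, Theorem 1 and its corollaries] -/
theorem finitePinningFloorOne_exp_dictionary (hN : nesterenko) (F : Submodule A ℝ) :
    PeriodPackage cexp ∧ AgreesOn cexp F ∧
      (KleinPolarE cexp ↔ Summit.Schanuel.Schanuel.Theses.RootDecomp1B.KleinPolarSchanuel) ∧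
      (Summit.Schanuel.Schanuel.Theses.RootDecomp1B.KleinPolarSchanuel →
        ∀ r : ℝ, r ≠ 0 → KleinPolarCellOne cexp r) ∧
      (LocalSurplusBudgetE cexp ↔ Summit.Schanuel.Schanuel.Theses.RootDecomp1B.LocalSurplusBudget) ∧
      (TameDefectZeroStepE cexp ↔ Summit.Schanuel.Schanuel.Theses.RootDecomp1B.TameDefectZeroStep) ∧
      (SchanuelE cexp ↔ Schanuel) :=
  ⟨periodPackage_exp hN, agreesOn_exp F, kleinPolarE_exp_iff,
    fun hX _ hr => kleinPolarCellOne_of_kleinPolarE (kleinPolarE_exp_iff.mpr hX) hr,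
    localSurplusBudgetE_exp_iff, tameDefectZeroStepE_exp_iff, schanuelE_exp_iff⟩

end Summit.Schanuel.Schanuel.Theorems.RootDecomp1BFinitePinningFloor

end
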